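import Literature.IUT.LogThetaLattice.StripFrameThetaLinks
import Literature.IUT.LogThetaLattice.ThetaMonoids

/-!
# [IUTchII] Cor 4.10 (iv) coricity of `F^{⊢×μ}`-prime-strips from [IUTchIII] Thm 2.2 (i) (bridge)

Proof-only bridge (abc-iut cell, wave-3 discharge seat abc-iut-L6-d1; no new definitions, no typer file
edited). In the tree, the coricity clause of [IUTchII] Cor 4.10 (iv) p. 160 — "`(−)F^{⊢×μ}_△` is an invariant
of both the `Θ^{×μ}`- and `Θ^{×μ}_{gau}`-links", typed by abc-iut-L6-t2 as the named statement
`HodgeTheaterStrips.UnitMuCoric` (`ThetaGauLinks.lean`) and reduced over the prime-strip frame to the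
frame-level property "`F^{⊩▶×μ} ↦ F^{⊢×μ}` carries full poly-isomorphisms onto full poly-isomorphisms"
(`HodgeTheaterStrips.unitMuCoric_of_map_full`, `StripFrameThetaLinks.lean`) — and the clause of
[IUTchIII] Thm 2.2 (i) p. 65 "the second arrows in each line are surjections", i.e.
`Aut_{F^{⊩▶×μ}}(−) ↠ Aut_{F^{⊢×μ}}(−)`, typed by abc-iut-L6-t3 as the field
`ThetaMonoidData.mapAut_surjective` (`ThetaMonoids.lean`), are the SAME mathematical fact seen at the level
of automorphism groups resp. of `Isom`-sets. This file records the implication in the kernel: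

* `mapIso_surjective_of_mapAut_surjective` — for any functor, surjectivity on the automorphism group of
  `X` plus one isomorphism `X ≅ Y` give surjectivity on `Isom(X, Y)` (pure category theory);
* `map_full_fglxmToFxm` — hence, given the [IUTchIII] Prop 2.1 / Thm 2.2 data `ThetaMonoidData S` over a
  strip frame `S`, the functor `S.FglxmToFxm` carries every full poly-isomorphism of `F^{⊩▶×μ}`-prime-strips
  onto the full poly-isomorphism of `F^{⊢×μ}`-prime-strips (any two `F^{⊩▶×μ}`-prime-strips being
  isomorphic, `StripFrame.iso_nonempty_Fglxm`, [IUTchII] Def 4.9 (viii));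
* `unitMuCoric_of_thetaMonoidData` — **IUTchII:Cor4.10(iv)** `UnitMuCoric` for every pair of Hodge
  theaters over the frame-induced setting, DISCHARGED modulo **IUTchIII:Thm2.2(i)** as typed.

S. Mochizuki, *Inter-universal Teichmüller theory II*, kurims Dec-2020 manuscript, Cor. 4.10 (iv) p. 160;
*III*, kurims May-2020 manuscript, Thm. 2.2 (i) p. 65. Claim key `Mochizuki2012`, status DISPUTED
(D-0012): bookkeeping over interfaces; nothing here asserts a disputed claim or takes a side on
[IUTchIII] Cor. 3.12 (typed ≠ discharged: the surjectivity clause of Thm. 2.2 (i) remains an INTERFACE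
FIELD, i.e. a hypothesis, until the prime-strip categories are real).
-/

namespace Literature.IUT.LogThetaLattice

open CategoryTheory
open Literature.IUT.HodgeTheaters (PolyIso)
open Literature.IUT.HodgeArakelov

universe v u v' u'

/-! ### Automorphism-surjectivity gives isomorphism-surjectivity -/

section Categorical

variable {C : Type u} [Category.{v} C] {D : Type u'} [Category.{v'} D]

/-- If a functor `Φ` is surjective on the automorphism group of `X` and `X ≅ Y`, then `Φ` is surjective
on `Isom(X, Y)`: lift `φ ≫ Φ(e)⁻¹ ∈ Aut(Φ X)` to `a ∈ Aut(X)` and take `a ≫ e` ([IUTchIII] Thm 2.2 (i)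
"surjections" on `Aut` versus [IUTchII] Cor 4.10 (iv) / [IUTchI] Cor 5.3 (iii) "surjective" on `Isom`).
[cite: Mochizuki2012, Thm 2.2 (i) p.65] -/
theorem mapIso_surjective_of_mapAut_surjective (Φ : C ⥤ D) {X Y : C} (e : X ≅ Y)
    (h : Function.Surjective (Φ.mapAut X)) :
    Function.Surjective (Φ.mapIso : (X ≅ Y) → (Φ.obj X ≅ Φ.obj Y)) := by
  intro φ
  obtain ⟨a, ha⟩ := h (φ ≪≫ (Φ.mapIso e).symm)
  refine ⟨a ≪≫ e, ?_⟩
  have ha' : Φ.mapIso a = φ ≪≫ (Φ.mapIso e).symm := ha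
  rw [Functor.mapIso_trans, ha', Iso.trans_assoc, Iso.symm_self_id, Iso.trans_refl]

/-- Conversely, surjectivity on `Isom(X, X)` is surjectivity on `Aut(X)` (the two are the same map).
[cite: Mochizuki2012, Thm 2.2 (i) p.65] -/
theorem mapAut_surjective_of_mapIso_surjective (Φ : C ⥤ D) {X : C}
    (h : Function.Surjective (Φ.mapIso : (X ≅ X) → (Φ.obj X ≅ Φ.obj X))) :
    Function.Surjective (Φ.mapAut X) := h

end Categorical

/-! ### Cor 4.10 (iv) from Thm 2.2 (i) over a strip frame -/

section Frame

variable {S : StripFrame.{u}}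

/-- **IUTchIII:Thm2.2(i)** (kurims p.65, "the second arrows in each line are surjections",
`Aut_{F^{⊩▶×μ}}(−) ↠ Aut_{F^{⊢×μ}}(−)`) ⟹ the frame-level property used by the tree's reduction of
[IUTchII] Cor 4.10 (iv): `F^{⊩▶×μ} ↦ F^{⊢×μ}` carries the FULL poly-isomorphism between ANY two
`F^{⊩▶×μ}`-prime-strips onto the full poly-isomorphism (any two such strips are isomorphic,
`StripFrame.iso_nonempty_Fglxm`, [IUTchII] Def 4.9 (viii)). [claim: Mochizuki2012, status: disputed] -/
theorem map_full_fglxmToFxm (T : ThetaMonoidData S) (X Y : S.Fglxm) :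
    (PolyIso.full X Y).map S.FglxmToFxm = PolyIso.full _ _ :=
  (mapIso_surjective_iff_map_full S.FglxmToFxm X Y).mp
    (mapIso_surjective_of_mapAut_surjective S.FglxmToFxm (S.iso_nonempty_Fglxm X Y).some
      (T.mapAut_surjective X))

/-- **IUTchII:Cor4.10(iv)** (kurims p.160) "`(−)F^{⊢×μ}_△` is an invariant of both the `Θ^{×μ}`- and
`Θ^{×μ}_{gau}`-links" — the named statement `HodgeTheaterStrips.UnitMuCoric` of `ThetaGauLinks.lean` — HOLDS
for every pair of `Θ^{±ell}NF`-Hodge theaters (through their strips) over the setting induced by a strip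
frame, as soon as the frame carries the [IUTchIII] Prop 2.1 / Thm 2.2 data `ThetaMonoidData` (whose field
`mapAut_surjective` is **IUTchIII:Thm2.2(i)**): DISCHARGED modulo that typed interface, via the owner's
reduction `unitMuCoric_of_map_full`. [claim: Mochizuki2012, status: disputed] -/
theorem unitMuCoric_of_thetaMonoidData (T : ThetaMonoidData S)
    (dag ddag : HodgeTheaterStrips (ThetaLinkSetting.ofStripFrame S)) : dag.UnitMuCoric ddag :=
  dag.unitMuCoric_of_map_full ddag (map_full_fglxmToFxm T)

/-- The same coricity along an infinite chain of `Θ^{×μ}_{gau}`-links ([IUTchII] Cor 4.10 (vi) p.161: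
`… ⟶ ⁽ⁿ⁻¹⁾HT ⟶ ⁿHT ⟶ ⁽ⁿ⁺¹⁾HT ⟶ …`): every link of a `ThetaGauChain` over the frame-induced setting has
coric `F^{⊢×μ}`-prime-strips. [claim: Mochizuki2012, status: disputed] -/
theorem unitMuCoric_chain (T : ThetaMonoidData S) (P : ThetaGauChain (ThetaLinkSetting.ofStripFrame S))
    (n : ℤ) : (P.theater n).UnitMuCoric (P.theater (n + 1)) :=
  unitMuCoric_of_thetaMonoidData T _ _

end Frame

end Literature.IUT.LogThetaLattice
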